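import Literature.NumberTheory.Sieve.BombieriFriedlanderIwaniecDispersionProofs
import Literature.NumberTheory.Sieve.BombieriFriedlanderIwaniecDispersionSeparation
import HarnessLib

/-!
# Bombieri–Friedlander–Iwaniec 1986, Theorem 2: the numerics of the eight error terms

Topic `Literature/NumberTheory/Sieve`.  Part of the assembly of **Theorem 2** (the named fact
`Literature.NumberTheory.Sieve.BombieriFriedlanderIwaniecTheorem2`) of E. Bombieri, J. B. Friedlander,
H. Iwaniec, *Primes in arithmetic progressions to large moduli*, Acta Math. 156 (1986), 203–251.
The sibling files `…Theorem2Errors`, `…Theorem2R1` bound the eight terms of the skeleton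
`BFI.dispG_le_errors` in pre-asymptotic form (explicit polynomials in `M, N, Q, R`, the parameters
`Q₀, z, H, …`, logarithms and divisor-moment constants).  This file PROVES, term by term, that each such
bound is `≤ ‖β‖² x R⁻¹ (log x)^{−A}` once the parameters satisfy explicit "saving" inequalities
(`BFI.e1_num` … `BFI.e8_num`); it is pure real arithmetic (`Y = M/2`, `MN = x`, `log(4Q) ≤ 2 log x`,
…) and contains no number theory.  The range of Theorem 2 enters through `N ≤ x^{1−ε₀}`,
`QNR ≤ 2x^{1−ε₀}` (for `𝒮₂`), `QR² ≤ …`, and, for `ℛ₁` (`BFI.e4_num`, BFI (9.21)), the three inequalities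
`NQ/√R, (N^{5/2}Q)^{1/2}, (N²Q^{3/2})^{1/2} ≤ x^{1/2−ε₀}` which are conditions (i)–(iii) of Theorem 2.
Everything here is PROVED; no named facts are introduced.

## References

* E. Bombieri, J. B. Friedlander, H. Iwaniec, Acta Math. 156 (1986), 203–251, §3 (3.3), §9 (9.21)
  p. 231. [BombieriFriedlanderIwaniecActa1986]
-/

noncomputable section

open Finset Real

namespace Literature.NumberTheory.Sieve

namespace BFI

/-! ### Logarithms of the parameters against `Λ = log x` -/

/-- For `x ≥ 16` and `0 < u ≤ 2x`: `log(8u) ≤ 3 log x` and `log (4u) ≤ 2 log x`… we record the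
forms used: `u ≤ 2x ⟹ log(4u) ≤ 2 log x`, `1 + log(4u) ≤ 2 log x` (for `u ≤ x`). [folklore] -/
theorem log_four_mul_le {x u : ℝ} (hx : 16 ≤ x) (hu0 : 0 < u) (hu : u ≤ 2 * x) :
    Real.log (4 * u) ≤ 2 * Real.log x := by
  have hx0 : 0 < x := by linarith
  have e : 2 * Real.log x = Real.log (x * x) := by rw [Real.log_mul hx0.ne' hx0.ne']; ring
  rw [e]
  exact Real.log_le_log (by positivity) (by nlinarith)

/-- `log(8u) ≤ 2 log x` for `x ≥ 16`, `0 < u ≤ 2x`. [folklore] -/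
theorem log_eight_mul_le {x u : ℝ} (hx : 16 ≤ x) (hu0 : 0 < u) (hu : u ≤ 2 * x) :
    Real.log (4 * (2 * u)) ≤ 2 * Real.log x := by
  have hx0 : 0 < x := by linarith
  have e : 2 * Real.log x = Real.log (x * x) := by rw [Real.log_mul hx0.ne' hx0.ne']; ring
  rw [e]
  exact Real.log_le_log (by positivity) (by nlinarith)

/-- `1 + log(4u) ≤ 2 log x` for `x ≥ 16`, `0 < u ≤ x` (`e · 4u ≤ 12x ≤ x²`). [folklore] -/
theorem one_add_log_four_mul_le {x u : ℝ} (hx : 16 ≤ x) (hu0 : 0 < u) (hu : u ≤ x) :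
    1 + Real.log (4 * u) ≤ 2 * Real.log x := by
  have hx0 : 0 < x := by linarith
  have he : Real.exp 1 ≤ 3 := by
    have := Real.exp_one_lt_d9; linarith
  have h1 : 1 + Real.log (4 * u) = Real.log (Real.exp 1 * (4 * u)) := by
    rw [Real.log_mul (Real.exp_pos 1).ne' (by positivity), Real.log_exp]
  have e : 2 * Real.log x = Real.log (x * x) := by rw [Real.log_mul hx0.ne' hx0.ne']; ring
  rw [h1, e]
  refine Real.log_le_log (by positivity) ?_
  calc Real.exp 1 * (4 * u) ≤ 3 * (4 * x) := mul_le_mul he (by linarith) (by positivity) (by norm_num)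
    _ ≤ x * x := by nlinarith

/-- `log(2u) ≤ 2 log x` for `x ≥ 16`, `0 < u ≤ x`. [folklore] -/
theorem log_two_mul_le {x u : ℝ} (hx : 16 ≤ x) (hu0 : 0 < u) (hu : u ≤ x) :
    Real.log (2 * u) ≤ 2 * Real.log x := by
  have hx0 : 0 < x := by linarith
  have e : 2 * Real.log x = Real.log (x * x) := by rw [Real.log_mul hx0.ne' hx0.ne']; ring
  rw [e]
  exact Real.log_le_log (by positivity) (by nlinarith)

/-- Powers of logs: if `0 ≤ L ≤ 2Λ` then `L^k ≤ 2^k Λ^k`. [folklore] -/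
theorem pow_le_two_pow_mul {L Λ : ℝ} (hL0 : 0 ≤ L) (hL : L ≤ 2 * Λ) (k : ℕ) :
    L ^ k ≤ (2 : ℝ) ^ k * Λ ^ k := by
  rw [← mul_pow]; exact pow_le_pow_left₀ hL0 hL k

/-! ### E8 and E7 -/

/-- **E8 numerics**: `(8+K₂)(2N+1)S₂(4C₁(log 4Q)^{k₁})²(4C₃(log 4R)^{k₃})/R ≤ S₂ x R⁻¹ (log x)^{−A}`
once `N ≤ x^{1−ε₀}` and `K (log x)^{2k₁+k₃} (log x)^A ≤ x^{ε₀}` with `K = 3(8+K₂)(4C₁)²(4C₃)2^{2k₁+k₃}`.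
[folklore] -/
theorem e8_num {x N Q R S₂ A ε₀ C₁ C₃ K2 : ℝ} {k₁ k₃ : ℕ} (hx : 16 ≤ x) (hN0 : 1 ≤ N)
    (hN2 : N ≤ x ^ (1 - ε₀)) (hQ : 1 / 2 ≤ Q) (hQx : Q ≤ 2 * x) (hR : 1 / 2 ≤ R) (hRx : R ≤ 2 * x)
    (hS₂ : 0 ≤ S₂) (hC₁ : 0 ≤ C₁) (hC₃ : 0 ≤ C₃) (hK2 : 0 ≤ K2)
    (hev : 3 * (8 + K2) * (4 * C₁) ^ 2 * (4 * C₃) * (2 : ℝ) ^ (2 * k₁ + k₃) *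
      Real.log x ^ (2 * k₁ + k₃) * Real.log x ^ A ≤ x ^ ε₀) :
    (8 + K2) * ((2 * N + 1) * S₂) * (4 * C₁ * Real.log (4 * Q) ^ k₁) ^ 2 *
        (4 * C₃ * Real.log (4 * R) ^ k₃ / R) ≤ S₂ * x * R⁻¹ / Real.log x ^ A := by
  have hx0 : 0 < x := by linarith
  have hR0 : 0 < R := by linarith
  have hQ0 : 0 < Q := by linarith
  have hΛ : 1 ≤ Real.log x := by
    rw [Real.le_log_iff_exp_le hx0]; have := Real.exp_one_lt_d9; linarith
  have hΛ0 : 0 < Real.log x := by linarith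
  have hlogQ := log_four_mul_le hx hQ0 hQx
  have hlogR := log_four_mul_le hx hR0 hRx
  have hlogQ0 : 0 ≤ Real.log (4 * Q) := Real.log_nonneg (by linarith)
  have hlogR0 : 0 ≤ Real.log (4 * R) := Real.log_nonneg (by linarith)
  have h1 : Real.log (4 * Q) ^ k₁ ≤ (2 : ℝ) ^ k₁ * Real.log x ^ k₁ := pow_le_two_pow_mul hlogQ0 hlogQ k₁
  have h3 : Real.log (4 * R) ^ k₃ ≤ (2 : ℝ) ^ k₃ * Real.log x ^ k₃ := pow_le_two_pow_mul hlogR0 hlogR k₃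
  have hN3 : 2 * N + 1 ≤ 3 * N := by linarith
  -- main chain
  have hLA : 0 < Real.log x ^ A := Real.rpow_pos_of_pos hΛ0 A
  rw [le_div_iff₀ hLA]
  calc (8 + K2) * ((2 * N + 1) * S₂) * (4 * C₁ * Real.log (4 * Q) ^ k₁) ^ 2 *
        (4 * C₃ * Real.log (4 * R) ^ k₃ / R) * Real.log x ^ A
      ≤ (8 + K2) * ((3 * N) * S₂) * (4 * C₁ * ((2 : ℝ) ^ k₁ * Real.log x ^ k₁)) ^ 2 *
        (4 * C₃ * ((2 : ℝ) ^ k₃ * Real.log x ^ k₃) / R) * Real.log x ^ A := by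
        gcongr
    _ = S₂ * R⁻¹ * N * (3 * (8 + K2) * (4 * C₁) ^ 2 * (4 * C₃) * (2 : ℝ) ^ (2 * k₁ + k₃) *
        Real.log x ^ (2 * k₁ + k₃) * Real.log x ^ A) := by
        rw [show 2 * k₁ + k₃ = k₁ + k₁ + k₃ by ring, pow_add, pow_add, pow_add, pow_add]
        field_simp
    _ ≤ S₂ * R⁻¹ * x ^ (1 - ε₀) * x ^ ε₀ := by
        have h0 : 0 ≤ 3 * (8 + K2) * (4 * C₁) ^ 2 * (4 * C₃) * (2 : ℝ) ^ (2 * k₁ + k₃) *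
            Real.log x ^ (2 * k₁ + k₃) * Real.log x ^ A := by positivity
        exact mul_le_mul (mul_le_mul_of_nonneg_left hN2 (by positivity)) hev h0 (by positivity)
    _ = S₂ * x * R⁻¹ := by
        rw [mul_assoc, ← Real.rpow_add hx0, show 1 - ε₀ + ε₀ = 1 by ring, Real.rpow_one]; ring

/-- **E7 numerics**: `2(8+K₂)(2N+1)S₂(4C_bQ(log4Q)^{k_b})(4C₂(log 4Q)^{k₂})(4C₀(log 4R)^{k₀}) ≤ S₂xR⁻¹(log x)^{−A}`
once `QNR ≤ 2x^{1−ε₀}` and `K(log x)^{k_b+k₂+k₀}(log x)^A ≤ x^{ε₀}`, `K = 12(8+K₂)(4C_b)(4C₂)(4C₀)2^{k_b+k₂+k₀}`.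
[folklore] -/
theorem e7_num {x N Q R S₂ A ε₀ Cb C₂ C₀ K2 : ℝ} {kb k₂ k₀ : ℕ} (hx : 16 ≤ x) (hN0 : 1 ≤ N)
    (hQ : 1 / 2 ≤ Q) (hQx : Q ≤ 2 * x) (hR : 1 / 2 ≤ R) (hRx : R ≤ 2 * x)
    (hQNR : Q * N * R ≤ 2 * x ^ (1 - ε₀)) (hS₂ : 0 ≤ S₂) (hCb : 0 ≤ Cb) (hC₂ : 0 ≤ C₂)
    (hC₀ : 0 ≤ C₀) (hK2 : 0 ≤ K2)
    (hev : 12 * (8 + K2) * (4 * Cb) * (4 * C₂) * (4 * C₀) * (2 : ℝ) ^ (kb + k₂ + k₀) *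
      Real.log x ^ (kb + k₂ + k₀) * Real.log x ^ A ≤ x ^ ε₀) :
    2 * (8 + K2) * ((2 * N + 1) * S₂) *
        ((4 * Cb * Q * Real.log (4 * Q) ^ kb) * (4 * C₂ * Real.log (4 * Q) ^ k₂) *
          (4 * C₀ * Real.log (4 * R) ^ k₀)) ≤ S₂ * x * R⁻¹ / Real.log x ^ A := by
  have hx0 : 0 < x := by linarith
  have hR0 : 0 < R := by linarith
  have hQ0 : 0 < Q := by linarith
  have hΛ : 1 ≤ Real.log x := by
    rw [Real.le_log_iff_exp_le hx0]; have := Real.exp_one_lt_d9; linarith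
  have hΛ0 : 0 < Real.log x := by linarith
  have hlogQ := log_four_mul_le hx hQ0 hQx
  have hlogR := log_four_mul_le hx hR0 hRx
  have hlogQ0 : 0 ≤ Real.log (4 * Q) := Real.log_nonneg (by linarith)
  have hlogR0 : 0 ≤ Real.log (4 * R) := Real.log_nonneg (by linarith)
  have h1 : Real.log (4 * Q) ^ kb ≤ (2 : ℝ) ^ kb * Real.log x ^ kb := pow_le_two_pow_mul hlogQ0 hlogQ kb
  have h2 : Real.log (4 * Q) ^ k₂ ≤ (2 : ℝ) ^ k₂ * Real.log x ^ k₂ := pow_le_two_pow_mul hlogQ0 hlogQ k₂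
  have h3 : Real.log (4 * R) ^ k₀ ≤ (2 : ℝ) ^ k₀ * Real.log x ^ k₀ := pow_le_two_pow_mul hlogR0 hlogR k₀
  have hN3 : 2 * N + 1 ≤ 3 * N := by linarith
  have hLA : 0 < Real.log x ^ A := Real.rpow_pos_of_pos hΛ0 A
  rw [le_div_iff₀ hLA]
  calc 2 * (8 + K2) * ((2 * N + 1) * S₂) *
        ((4 * Cb * Q * Real.log (4 * Q) ^ kb) * (4 * C₂ * Real.log (4 * Q) ^ k₂) *
          (4 * C₀ * Real.log (4 * R) ^ k₀)) * Real.log x ^ A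
      ≤ 2 * (8 + K2) * ((3 * N) * S₂) *
        ((4 * Cb * Q * ((2 : ℝ) ^ kb * Real.log x ^ kb)) * (4 * C₂ * ((2 : ℝ) ^ k₂ * Real.log x ^ k₂)) *
          (4 * C₀ * ((2 : ℝ) ^ k₀ * Real.log x ^ k₀))) * Real.log x ^ A := by
        gcongr
    _ = S₂ * R⁻¹ * (Q * N * R) / 2 * (12 * (8 + K2) * (4 * Cb) * (4 * C₂) * (4 * C₀) * (2 : ℝ) ^ (kb + k₂ + k₀) *
        Real.log x ^ (kb + k₂ + k₀) * Real.log x ^ A) := by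
        rw [pow_add, pow_add, pow_add, pow_add]; field_simp; ring
    _ ≤ S₂ * R⁻¹ * (2 * x ^ (1 - ε₀)) / 2 * x ^ ε₀ := by
        have h0 : 0 ≤ 12 * (8 + K2) * (4 * Cb) * (4 * C₂) * (4 * C₀) * (2 : ℝ) ^ (kb + k₂ + k₀) *
            Real.log x ^ (kb + k₂ + k₀) * Real.log x ^ A := by positivity
        refine mul_le_mul ?_ hev h0 (by positivity)
        exact div_le_div_of_nonneg_right (mul_le_mul_of_nonneg_left hQNR (by positivity)) (by norm_num)
    _ = S₂ * x * R⁻¹ := by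
        have : x ^ (1 - ε₀) * x ^ ε₀ = x := by
          rw [← Real.rpow_add hx0, show 1 - ε₀ + ε₀ = 1 by ring, Real.rpow_one]
        field_simp
        rw [mul_assoc, this]


/-! ### E5 and E2 (the squarefree reduction): savings `z^{−1/4}` -/

/-- **E5 numerics**: with `Λ = log x`, `x ≥ 16`, `MN = x`, `N ≤ x`, `Q ≤ 2x`,
`(M+2(M/2))(Q₀/(Q²R))(4C_bQ(log 4Q)^{k_b})² · 2S₂ · c N (1+log 4N)^{k} / z^{1/4} ≤ S₂ x R⁻¹ Λ^{−A}`
once `64 c C_b² 2^{2k_b+k} Q₀ Λ^{2k_b+k} Λ^A ≤ z^{1/4}`. [folklore] -/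
theorem e5_num {x M N Q R Q₀ S₂ A c Cb z : ℝ} {kb k : ℕ} (hx : 16 ≤ x) (hMN : M * N = x)
    (hN0 : 1 ≤ N) (hNx : N ≤ x) (hQ : 1 / 2 ≤ Q) (hQx : Q ≤ 2 * x) (hR : 0 < R) (hQ₀ : 0 ≤ Q₀)
    (hS₂ : 0 ≤ S₂) (hc : 0 ≤ c) (hz : 0 < z)
    (hsave : 64 * c * Cb ^ 2 * (2 : ℝ) ^ (2 * kb + k) * Q₀ * Real.log x ^ (2 * kb + k) * Real.log x ^ A ≤
      Real.sqrt (Real.sqrt z)) :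
    (M + 2 * (M / 2)) * (Q₀ / (Q ^ 2 * R) * (4 * Cb * Q * Real.log (4 * Q) ^ kb) ^ 2 *
        (2 * S₂ * (c * N * (1 + Real.log (4 * N)) ^ k / Real.sqrt (Real.sqrt z)))) ≤
      S₂ * x * R⁻¹ / Real.log x ^ A := by
  have hx0 : 0 < x := by linarith
  have hQ0 : 0 < Q := by linarith
  have hN00 : 0 < N := by linarith
  have hM0 : 0 < M := by
    by_contra h
    rw [not_lt] at h
    have : M * N ≤ 0 := mul_nonpos_of_nonpos_of_nonneg h hN00.le
    linarith
  have hΛ : 1 ≤ Real.log x := by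
    rw [Real.le_log_iff_exp_le hx0]; have := Real.exp_one_lt_d9; linarith
  have hΛ0 : 0 < Real.log x := by linarith
  have hsz : 0 < Real.sqrt (Real.sqrt z) := Real.sqrt_pos.2 (Real.sqrt_pos.2 hz)
  have hlogQ := log_four_mul_le hx hQ0 hQx
  have hlogQ0 : 0 ≤ Real.log (4 * Q) := Real.log_nonneg (by linarith)
  have hlogN := one_add_log_four_mul_le hx hN00 hNx
  have hlogN0 : 0 ≤ 1 + Real.log (4 * N) := by have := Real.log_nonneg (show (1:ℝ) ≤ 4 * N by linarith); linarith
  have h1 : Real.log (4 * Q) ^ kb ≤ (2 : ℝ) ^ kb * Real.log x ^ kb := pow_le_two_pow_mul hlogQ0 hlogQ kb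
  have h2 : (1 + Real.log (4 * N)) ^ k ≤ (2 : ℝ) ^ k * Real.log x ^ k := pow_le_two_pow_mul hlogN0 hlogN k
  have hLA : 0 < Real.log x ^ A := Real.rpow_pos_of_pos hΛ0 A
  rw [le_div_iff₀ hLA]
  -- rewrite the left side as `S₂ x R⁻¹ · (64 c Cb² Q₀ L_Q^{2kb} L_N^{k} / z^{1/4})`
  have e : (M + 2 * (M / 2)) * (Q₀ / (Q ^ 2 * R) * (4 * Cb * Q * Real.log (4 * Q) ^ kb) ^ 2 *
        (2 * S₂ * (c * N * (1 + Real.log (4 * N)) ^ k / Real.sqrt (Real.sqrt z)))) * Real.log x ^ A =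
      S₂ * x * R⁻¹ * ((64 * c * Cb ^ 2 * Q₀ * (Real.log (4 * Q) ^ kb) ^ 2 * (1 + Real.log (4 * N)) ^ k *
        Real.log x ^ A) / Real.sqrt (Real.sqrt z)) := by
    rw [← hMN]; field_simp; ring
  rw [e]
  have hkey : 64 * c * Cb ^ 2 * Q₀ * (Real.log (4 * Q) ^ kb) ^ 2 * (1 + Real.log (4 * N)) ^ k *
      Real.log x ^ A ≤ Real.sqrt (Real.sqrt z) := by
    refine le_trans ?_ hsave
    calc 64 * c * Cb ^ 2 * Q₀ * (Real.log (4 * Q) ^ kb) ^ 2 * (1 + Real.log (4 * N)) ^ k * Real.log x ^ A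
        ≤ 64 * c * Cb ^ 2 * Q₀ * ((2 : ℝ) ^ kb * Real.log x ^ kb) ^ 2 * ((2 : ℝ) ^ k * Real.log x ^ k) *
            Real.log x ^ A := by gcongr
      _ = _ := by rw [show 2 * kb + k = kb + kb + k by ring, pow_add, pow_add, pow_add, pow_add]; ring
  calc S₂ * x * R⁻¹ * ((64 * c * Cb ^ 2 * Q₀ * (Real.log (4 * Q) ^ kb) ^ 2 * (1 + Real.log (4 * N)) ^ k *
        Real.log x ^ A) / Real.sqrt (Real.sqrt z))
      ≤ S₂ * x * R⁻¹ * 1 := by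
        refine mul_le_mul_of_nonneg_left ?_ (by positivity)
        rw [div_le_one hsz]; exact hkey
    _ = S₂ * x * R⁻¹ := mul_one _

/-- `√(√u · √v) · √w ≤ …`: for `N ≥ 1`, `L ≥ 1`, `z > 0`, `Cu, Cv ≥ 0`,
`√(√(4N/z) √(Cv N L^{kv})) · √(Cu N L^{ku}) ≤ √(Cu √(4Cv)) · N · L^{kv+ku} / z^{1/4}`. [folklore] -/
theorem e2_roots_le {N z L Cu Cv : ℝ} {ku kv : ℕ} (hN : 1 ≤ N) (hz : 0 < z) (hL : 1 ≤ L) (hCu : 0 ≤ Cu)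
    (hCv : 0 ≤ Cv) :
    Real.sqrt (Real.sqrt (4 * N / z) * Real.sqrt (Cv * N * L ^ kv)) * Real.sqrt (Cu * N * L ^ ku) ≤
      Real.sqrt (Cu * Real.sqrt (4 * Cv)) * N * L ^ (kv + ku) / Real.sqrt (Real.sqrt z) := by
  have hN0 : 0 < N := by linarith
  have hL0 : 0 < L := by linarith
  have hsz : 0 < Real.sqrt z := Real.sqrt_pos.2 hz
  have hssz : 0 < Real.sqrt (Real.sqrt z) := Real.sqrt_pos.2 hsz
  -- `√(4N/z) √(Cv N L^kv) = √(4Cv N² L^kv / z) ≤ N √(4Cv) L^kv / √z`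
  have hLk : ∀ k : ℕ, Real.sqrt (L ^ k) ≤ L ^ k := fun k => by
    have h1 : 1 ≤ L ^ k := one_le_pow₀ hL
    rw [Real.sqrt_le_left (by positivity)]
    nlinarith
  have h1 : Real.sqrt (4 * N / z) * Real.sqrt (Cv * N * L ^ kv) ≤ N * Real.sqrt (4 * Cv) * L ^ kv / Real.sqrt z := by
    rw [← Real.sqrt_mul (by positivity)]
    have e : 4 * N / z * (Cv * N * L ^ kv) = (N ^ 2 * (4 * Cv) / z) * L ^ kv := by ring
    rw [e, Real.sqrt_mul (by positivity), Real.sqrt_div (by positivity), Real.sqrt_mul (by positivity),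
      Real.sqrt_sq hN0.le]
    rw [div_mul_eq_mul_div]
    exact div_le_div_of_nonneg_right (mul_le_mul_of_nonneg_left (hLk kv) (by positivity)) hsz.le
  have h2 : Real.sqrt (Cu * N * L ^ ku) ≤ Real.sqrt (Cu * N) * L ^ ku := by
    rw [Real.sqrt_mul (by positivity)]
    exact mul_le_mul_of_nonneg_left (hLk ku) (Real.sqrt_nonneg _)
  calc Real.sqrt (Real.sqrt (4 * N / z) * Real.sqrt (Cv * N * L ^ kv)) * Real.sqrt (Cu * N * L ^ ku)
      ≤ Real.sqrt (N * Real.sqrt (4 * Cv) * L ^ kv / Real.sqrt z) * (Real.sqrt (Cu * N) * L ^ ku) :=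
        mul_le_mul (Real.sqrt_le_sqrt h1) h2 (Real.sqrt_nonneg _) (Real.sqrt_nonneg _)
    _ = Real.sqrt (N * Real.sqrt (4 * Cv) / Real.sqrt z) * Real.sqrt (L ^ kv) * (Real.sqrt (Cu * N) * L ^ ku) := by
        rw [show N * Real.sqrt (4 * Cv) * L ^ kv / Real.sqrt z = (N * Real.sqrt (4 * Cv) / Real.sqrt z) * L ^ kv by ring,
          Real.sqrt_mul (by positivity)]
    _ ≤ Real.sqrt (N * Real.sqrt (4 * Cv) / Real.sqrt z) * L ^ kv * (Real.sqrt (Cu * N) * L ^ ku) := by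
        gcongr
        exact hLk kv
    _ = Real.sqrt (Cu * Real.sqrt (4 * Cv)) * N * L ^ (kv + ku) / Real.sqrt (Real.sqrt z) := by
        set s := Real.sqrt N with hs_def
        have hs : s * s = N := Real.mul_self_sqrt hN0.le
        rw [Real.sqrt_div (by positivity), Real.sqrt_mul (by positivity) (Real.sqrt (4 * Cv)),
          Real.sqrt_mul hCu, Real.sqrt_mul hCu, pow_add, ← hs_def, ← hs]
        field_simp

set_option maxHeartbeats 800000 in
/-- **E2 numerics**: with `Λ = log x`, `x ≥ 16`, `MN = x`, `N ≤ x`, `Q ≤ 2x`, `0 ≤ lg ≤ 2Λ`,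
`L_N = 1 + log 4N`, the right-hand side of `BFI.e2_le` (at `Y = M/2`) is `≤ S₂ x R⁻¹ Λ^{−A}` once
`5C₃2^{B₃}Λ^{B₃} · 4C_Γ 2^{k_Γ}Λ^{k_Γ} · √(6(Cu+Cu')√(4·6(Cv+Cv'))) · 2^{k}Λ^{k} · Λ^A ≤ z^{1/4}`
(`k = kv+kv'+ku+ku'`). [folklore] -/
theorem e2_num {x M N Q R S₂ A z lg C₃ B₃ CΓ Cu Cu' Cv Cv' : ℝ} {kΓ ku ku' kv kv' : ℕ} (hx : 16 ≤ x)
    (hMN : M * N = x) (hN0 : 1 ≤ N) (hNx : N ≤ x) (hQ : 1 / 2 ≤ Q) (hQx : Q ≤ 2 * x) (hR : 0 < R)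
    (hS₂ : 0 ≤ S₂) (hz : 0 < z) (hlg0 : 0 ≤ lg) (hlg : lg ≤ 2 * Real.log x) (hC₃ : 0 ≤ C₃)
    (hB₃ : 0 ≤ B₃) (hCΓ : 0 ≤ CΓ) (hCu : 0 < Cu) (hCu' : 0 ≤ Cu') (hCv : 0 < Cv) (hCv' : 0 ≤ Cv')
    (hsave : 5 * C₃ * (2 : ℝ) ^ B₃ * Real.log x ^ B₃ * (4 * CΓ * (2 : ℝ) ^ kΓ * Real.log x ^ kΓ) *
      Real.sqrt (6 * (Cu + Cu') * Real.sqrt (4 * (6 * (Cv + Cv')))) *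
        ((2 : ℝ) ^ (kv + kv' + (ku + ku')) * Real.log x ^ (kv + kv' + (ku + ku'))) * Real.log x ^ A ≤
      Real.sqrt (Real.sqrt z)) :
    2 * (C₃ * (2 * M + M / 2) * lg ^ B₃ * (4 * CΓ * Real.log (4 * Q) ^ kΓ) * R⁻¹ * S₂) *
        (Real.sqrt (Real.sqrt (4 * N / z) * Real.sqrt (6 * (Cv + Cv') * N * (1 + Real.log (4 * N)) ^ (kv + kv'))) *
          Real.sqrt (6 * (Cu + Cu') * N * (1 + Real.log (4 * N)) ^ (ku + ku'))) ≤
      S₂ * x * R⁻¹ / Real.log x ^ A := by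
  have hx0 : 0 < x := by linarith
  have hQ0 : 0 < Q := by linarith
  have hN00 : 0 < N := by linarith
  have hM0 : 0 < M := by
    by_contra h
    rw [not_lt] at h
    have : M * N ≤ 0 := mul_nonpos_of_nonpos_of_nonneg h hN00.le
    linarith
  have hΛ : 1 ≤ Real.log x := by
    rw [Real.le_log_iff_exp_le hx0]; have := Real.exp_one_lt_d9; linarith
  have hΛ0 : 0 < Real.log x := by linarith
  have hsz : 0 < Real.sqrt (Real.sqrt z) := Real.sqrt_pos.2 (Real.sqrt_pos.2 hz)
  have hlogQ := log_four_mul_le hx hQ0 hQx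
  have hlogQ0 : 0 ≤ Real.log (4 * Q) := Real.log_nonneg (by linarith)
  set L : ℝ := 1 + Real.log (4 * N) with hLdef
  have hL1 : 1 ≤ L := by have := Real.log_nonneg (show (1:ℝ) ≤ 4 * N by linarith); rw [hLdef]; linarith
  have hLle : L ≤ 2 * Real.log x := one_add_log_four_mul_le hx hN00 hNx
  have hroots := e2_roots_le hN0 hz hL1 (show 0 ≤ 6 * (Cu + Cu') by positivity)
    (show 0 ≤ 6 * (Cv + Cv') by positivity) (ku := ku + ku') (kv := kv + kv')
  have hLA : 0 < Real.log x ^ A := Real.rpow_pos_of_pos hΛ0 A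
  -- bounds for the log factors
  have h1 : lg ^ B₃ ≤ (2 : ℝ) ^ B₃ * Real.log x ^ B₃ := by
    rw [← Real.mul_rpow (by norm_num) hΛ0.le]; exact Real.rpow_le_rpow hlg0 hlg hB₃
  have h2 : Real.log (4 * Q) ^ kΓ ≤ (2 : ℝ) ^ kΓ * Real.log x ^ kΓ := pow_le_two_pow_mul hlogQ0 hlogQ kΓ
  have h3 : L ^ (kv + kv' + (ku + ku')) ≤ (2 : ℝ) ^ (kv + kv' + (ku + ku')) * Real.log x ^ (kv + kv' + (ku + ku')) :=
    pow_le_two_pow_mul (by linarith) hLle _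
  set c₀ : ℝ := Real.sqrt (6 * (Cu + Cu') * Real.sqrt (4 * (6 * (Cv + Cv')))) with hc₀
  rw [le_div_iff₀ hLA]
  calc 2 * (C₃ * (2 * M + M / 2) * lg ^ B₃ * (4 * CΓ * Real.log (4 * Q) ^ kΓ) * R⁻¹ * S₂) *
        (Real.sqrt (Real.sqrt (4 * N / z) * Real.sqrt (6 * (Cv + Cv') * N * L ^ (kv + kv'))) *
          Real.sqrt (6 * (Cu + Cu') * N * L ^ (ku + ku'))) * Real.log x ^ A
      ≤ 2 * (C₃ * (2 * M + M / 2) * ((2 : ℝ) ^ B₃ * Real.log x ^ B₃) *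
          (4 * CΓ * ((2 : ℝ) ^ kΓ * Real.log x ^ kΓ)) * R⁻¹ * S₂) *
        (c₀ * N * ((2 : ℝ) ^ (kv + kv' + (ku + ku')) * Real.log x ^ (kv + kv' + (ku + ku'))) /
          Real.sqrt (Real.sqrt z)) * Real.log x ^ A := by
        have hlgB : 0 ≤ lg ^ B₃ := Real.rpow_nonneg hlg0 _
        refine mul_le_mul_of_nonneg_right (mul_le_mul ?_ (hroots.trans ?_) (by positivity) (by positivity)) hLA.le
        · gcongr
        · rw [hc₀]
          exact div_le_div_of_nonneg_right (mul_le_mul_of_nonneg_left h3 (by positivity)) hsz.le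
    _ = S₂ * x * R⁻¹ * ((5 * C₃ * (2 : ℝ) ^ B₃ * Real.log x ^ B₃ * (4 * CΓ * (2 : ℝ) ^ kΓ * Real.log x ^ kΓ) * c₀ *
          ((2 : ℝ) ^ (kv + kv' + (ku + ku')) * Real.log x ^ (kv + kv' + (ku + ku'))) * Real.log x ^ A) /
            Real.sqrt (Real.sqrt z)) := by
        rw [← hMN]; ring
    _ ≤ S₂ * x * R⁻¹ * 1 := by
        refine mul_le_mul_of_nonneg_left ?_ (by positivity)
        rw [div_le_one hsz]; exact hsave
    _ = S₂ * x * R⁻¹ := mul_one _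


/-! ### E6 -/

set_option maxHeartbeats 800000 in
/-- **E6 numerics**: the right-hand side of `BFI.e6_le` at `Y = M/2` is `≤ S₂ x R⁻¹ Λ^{−A}` once
`128 W Q₀ C²(2Λ)^{2k}Λ^A ≤ S₂N` (the Theorem 0 (a) saving), `2048C'²(2Λ)^{2k'+1}Λ^A ≤ z`,
`1024C'²(2Λ)^{2k'+1}Q₀Λ^A R ≤ N` and `12288C₁C'²C''(2Λ)^{k₁+2k'+k''}Λ^A ≤ Q₀` (`Λ = log x`).
[folklore] -/
theorem e6_num {x M N Q R S₂ A z Q₀ W C C' C₁ C'' : ℝ} {k k' k₁ k'' : ℕ} (hx : 32 ≤ x)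
    (hMN : M * N = x) (hN0 : 1 ≤ N) (hNx : N ≤ x) (hQ : 1 / 2 ≤ Q) (hQx : Q ≤ 2 * x) (hR : 1 / 2 ≤ R)
    (hRx : R ≤ 2 * x) (hS₂ : 0 ≤ S₂) (hz : 0 < z) (hQ₀ : 0 < Q₀) (hW : 0 ≤ W) (hC : 0 ≤ C)
    (hC' : 0 ≤ C') (hC₁ : 0 ≤ C₁) (hC'' : 0 ≤ C'')
    (hWa : 128 * W * Q₀ * C ^ 2 * (2 * Real.log x) ^ (2 * k) * Real.log x ^ A ≤ S₂ * N)
    (hzb : 2048 * C' ^ 2 * (2 * Real.log x) ^ (2 * k' + 1) * Real.log x ^ A ≤ z)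
    (hRN : 1024 * C' ^ 2 * (2 * Real.log x) ^ (2 * k' + 1) * Q₀ * Real.log x ^ A * R ≤ N)
    (hQ₀c : 12288 * C₁ * C' ^ 2 * C'' * (2 * Real.log x) ^ (k₁ + 2 * k' + k'') * Real.log x ^ A ≤ Q₀) :
    (M + 2 * (M / 2)) *
        ((W * Q₀ / R * (4 * C * Real.log (4 * Q) ^ k) ^ 2 +
          S₂ * (2 * Real.log (2 * N)) * (8 * N / (z * R) + 4 * Q₀) * (4 * C' * Real.log (4 * Q) ^ k') ^ 2) +
        ((2 * N + 1) * S₂) * (4 * C₁ * Real.log (4 * R) ^ k₁ / R) *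
          ((4 * C' * (1 + Real.log (4 * Q)) ^ k') ^ 2 * (8 * C'' * Real.log (4 * (2 * Q)) ^ k'' / Q₀))) ≤
      S₂ * x * R⁻¹ / Real.log x ^ A := by
  have hx16 : 16 ≤ x := by linarith
  have hx0 : 0 < x := by linarith
  have hQ0 : 0 < Q := by linarith
  have hR0 : 0 < R := by linarith
  have hN00 : 0 < N := by linarith
  have hM0 : 0 < M := by
    by_contra h
    rw [not_lt] at h
    have : M * N ≤ 0 := mul_nonpos_of_nonpos_of_nonneg h hN00.le
    linarith
  have hΛ : 1 ≤ Real.log x := by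
    rw [Real.le_log_iff_exp_le hx0]; have := Real.exp_one_lt_d9; linarith
  have hΛ0 : 0 < Real.log x := by linarith
  set Λ := Real.log x with hΛdef
  have hlogQ := log_four_mul_le hx16 hQ0 hQx
  have hlogQ0 : 0 ≤ Real.log (4 * Q) := Real.log_nonneg (by linarith)
  have hlogR := log_four_mul_le hx16 hR0 hRx
  have hlogR0 : 0 ≤ Real.log (4 * R) := Real.log_nonneg (by linarith)
  have hlog8Q := log_eight_mul_le hx16 hQ0 hQx
  have hlog8Q0 : 0 ≤ Real.log (4 * (2 * Q)) := Real.log_nonneg (by linarith)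
  have hlogN1 : 1 + Real.log (4 * Q) ≤ 2 * Λ := by
    have he : Real.exp 1 ≤ 3 := by have := Real.exp_one_lt_d9; linarith
    have h1 : 1 + Real.log (4 * Q) = Real.log (Real.exp 1 * (4 * Q)) := by
      rw [Real.log_mul (Real.exp_pos 1).ne' (by positivity), Real.log_exp]
    have e : 2 * Λ = Real.log (x * x) := by rw [hΛdef, Real.log_mul hx0.ne' hx0.ne']; ring
    rw [h1, e]
    refine Real.log_le_log (by positivity) ?_
    calc Real.exp 1 * (4 * Q) ≤ 3 * (4 * (2 * x)) := mul_le_mul he (by linarith) (by positivity) (by norm_num)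
      _ ≤ x * x := by nlinarith
  have hlogN10 : 0 ≤ 1 + Real.log (4 * Q) := by linarith
  have hlog2N := log_two_mul_le hx16 hN00 hNx
  have hlog2N0 : 0 ≤ Real.log (2 * N) := Real.log_nonneg (by linarith)
  have hLA : 0 < Λ ^ A := Real.rpow_pos_of_pos hΛ0 A
  have hN3 : 2 * N + 1 ≤ 3 * N := by linarith
  have hMN' : M + 2 * (M / 2) = 2 * M := by ring
  rw [hMN', le_div_iff₀ hLA]
  have hxMN : S₂ * x * R⁻¹ = S₂ * M * N * R⁻¹ := by rw [← hMN]; ring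
  -- (a)
  have ha : 2 * M * (W * Q₀ / R * (4 * C * Real.log (4 * Q) ^ k) ^ 2) * Λ ^ A ≤ S₂ * x * R⁻¹ / 4 := by
    calc 2 * M * (W * Q₀ / R * (4 * C * Real.log (4 * Q) ^ k) ^ 2) * Λ ^ A
        ≤ 2 * M * (W * Q₀ / R * (4 * C * (2 * Λ) ^ k) ^ 2) * Λ ^ A := by gcongr
      _ = M * R⁻¹ / 4 * (128 * W * Q₀ * C ^ 2 * (2 * Λ) ^ (2 * k) * Λ ^ A) := by
          rw [show 2 * k = k + k by ring, pow_add]; field_simp; ring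
      _ ≤ M * R⁻¹ / 4 * (S₂ * N) := mul_le_mul_of_nonneg_left hWa (by positivity)
      _ = S₂ * x * R⁻¹ / 4 := by rw [hxMN]; ring
  -- (b1) + (b2)
  have hb : 2 * M * (S₂ * (2 * Real.log (2 * N)) * (8 * N / (z * R) + 4 * Q₀) *
      (4 * C' * Real.log (4 * Q) ^ k') ^ 2) * Λ ^ A ≤ S₂ * x * R⁻¹ / 4 + S₂ * x * R⁻¹ / 4 := by
    have hb0 : 2 * M * (S₂ * (2 * Real.log (2 * N)) * (8 * N / (z * R) + 4 * Q₀) *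
        (4 * C' * Real.log (4 * Q) ^ k') ^ 2) * Λ ^ A ≤
        2 * M * (S₂ * (2 * (2 * Λ)) * (8 * N / (z * R) + 4 * Q₀) * (4 * C' * (2 * Λ) ^ k') ^ 2) * Λ ^ A := by
      gcongr
    refine hb0.trans ?_
    have e : 2 * M * (S₂ * (2 * (2 * Λ)) * (8 * N / (z * R) + 4 * Q₀) * (4 * C' * (2 * Λ) ^ k') ^ 2) * Λ ^ A =
        S₂ * M * N * R⁻¹ / 4 * ((2048 * C' ^ 2 * (2 * Λ) ^ (2 * k' + 1) * Λ ^ A) / z) +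
        S₂ * M * R⁻¹ / 4 * (1024 * C' ^ 2 * (2 * Λ) ^ (2 * k' + 1) * Q₀ * Λ ^ A * R) := by
      rw [show 2 * k' + 1 = k' + k' + 1 by ring, pow_add, pow_add, pow_one]; field_simp; ring
    rw [e, hxMN]
    refine add_le_add ?_ ?_
    · calc S₂ * M * N * R⁻¹ / 4 * ((2048 * C' ^ 2 * (2 * Λ) ^ (2 * k' + 1) * Λ ^ A) / z)
          ≤ S₂ * M * N * R⁻¹ / 4 * 1 := by
            refine mul_le_mul_of_nonneg_left ?_ (by positivity)
            rw [div_le_one hz]; exact hzb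
        _ = _ := mul_one _
    · calc S₂ * M * R⁻¹ / 4 * (1024 * C' ^ 2 * (2 * Λ) ^ (2 * k' + 1) * Q₀ * Λ ^ A * R)
          ≤ S₂ * M * R⁻¹ / 4 * N := mul_le_mul_of_nonneg_left hRN (by positivity)
        _ = _ := by ring
  -- (c)
  have hc : 2 * M * ((2 * N + 1) * S₂ * (4 * C₁ * Real.log (4 * R) ^ k₁ / R) *
      ((4 * C' * (1 + Real.log (4 * Q)) ^ k') ^ 2 * (8 * C'' * Real.log (4 * (2 * Q)) ^ k'' / Q₀))) * Λ ^ A ≤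
      S₂ * x * R⁻¹ / 4 := by
    calc 2 * M * ((2 * N + 1) * S₂ * (4 * C₁ * Real.log (4 * R) ^ k₁ / R) *
          ((4 * C' * (1 + Real.log (4 * Q)) ^ k') ^ 2 * (8 * C'' * Real.log (4 * (2 * Q)) ^ k'' / Q₀))) * Λ ^ A
        ≤ 2 * M * ((3 * N) * S₂ * (4 * C₁ * (2 * Λ) ^ k₁ / R) *
          ((4 * C' * (2 * Λ) ^ k') ^ 2 * (8 * C'' * (2 * Λ) ^ k'' / Q₀))) * Λ ^ A := by gcongr
      _ = S₂ * M * N * R⁻¹ / 4 * ((12288 * C₁ * C' ^ 2 * C'' * (2 * Λ) ^ (k₁ + 2 * k' + k'') * Λ ^ A) / Q₀) := by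
          rw [show k₁ + 2 * k' + k'' = k₁ + k' + k' + k'' by ring, pow_add, pow_add, pow_add]; field_simp; ring
      _ ≤ S₂ * M * N * R⁻¹ / 4 * 1 := by
          refine mul_le_mul_of_nonneg_left ?_ (by positivity)
          rw [div_le_one hQ₀]; exact hQ₀c
      _ = S₂ * x * R⁻¹ / 4 := by rw [hxMN, mul_one]
  have e : 2 * M * (W * Q₀ / R * (4 * C * Real.log (4 * Q) ^ k) ^ 2 +
        S₂ * (2 * Real.log (2 * N)) * (8 * N / (z * R) + 4 * Q₀) * (4 * C' * Real.log (4 * Q) ^ k') ^ 2 +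
        (2 * N + 1) * S₂ * (4 * C₁ * Real.log (4 * R) ^ k₁ / R) *
          ((4 * C' * (1 + Real.log (4 * Q)) ^ k') ^ 2 * (8 * C'' * Real.log (4 * (2 * Q)) ^ k'' / Q₀))) * Λ ^ A =
      2 * M * (W * Q₀ / R * (4 * C * Real.log (4 * Q) ^ k) ^ 2) * Λ ^ A +
      2 * M * (S₂ * (2 * Real.log (2 * N)) * (8 * N / (z * R) + 4 * Q₀) * (4 * C' * Real.log (4 * Q) ^ k') ^ 2) * Λ ^ A +
      2 * M * ((2 * N + 1) * S₂ * (4 * C₁ * Real.log (4 * R) ^ k₁ / R) *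
        ((4 * C' * (1 + Real.log (4 * Q)) ^ k') ^ 2 * (8 * C'' * Real.log (4 * (2 * Q)) ^ k'' / Q₀))) * Λ ^ A := by
    ring
  rw [e]
  linarith [ha, hb, hc]


/-! ### E1 -/

set_option maxHeartbeats 800000 in
/-- **E1 numerics**: the right-hand side of `BFI.e1_le` at `Y = M/2` is `≤ S₂ x R⁻¹ Λ^{−A}` once
(with `Λ = log x`, `Φ = T(4Λ+1)(4C_e(2Λ)^{k_e})`)
`1280 C₃C₄2^{B₃}(2Λ)^{B₃}(2Λ)^{B₄}C_aC_c(2Λ)^{k_a+k_c}ΛΛ^A ≤ z`, `320C₃C₄(2Λ)^{B₃}(2Λ)^{B₄}C_dC_c(2Λ)^{k_d+k_c}Λ^A ≤ Q₀`,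
`320ΦΛ^A ≤ P₀`, `128ΦΛ^A QNR ≤ xP₀`, `160ΦΛ^A R ≤ N`, `64ΦΛ^A QR² ≤ x`. [folklore] -/
theorem e1_num {x M N Q R S₂ A z Q₀ P₀ T lg ω₀ C₃ B₃ C₄ B₄ Ca Cc Cd Ce : ℝ} {ka kc kd ke : ℕ}
    (hx : 16 ≤ x) (hMN : M * N = x) (hN0 : 1 ≤ N) (hNx : N ≤ x) (hMx : M ≤ x) (hQ : 1 / 2 ≤ Q)
    (hQx : Q ≤ 2 * x) (hR : 1 / 2 ≤ R) (hRx : R ≤ 2 * x) (hS₂ : 0 ≤ S₂) (hz : 0 < z) (hQ₀ : 0 < Q₀)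
    (hP₀ : 0 < P₀) (hT : 0 ≤ T) (hlg0 : 0 ≤ lg) (hlg : lg ≤ 2 * Real.log x)
    (hω₀ : ω₀ ≤ 4 * Real.log x) (hC₃ : 0 ≤ C₃) (hB₃ : 0 ≤ B₃) (hC₄ : 0 ≤ C₄) (hB₄ : 0 ≤ B₄)
    (hCa : 0 ≤ Ca) (hCc : 0 ≤ Cc) (hCd : 0 ≤ Cd) (hCe : 0 ≤ Ce)
    (hz1 : 1280 * C₃ * C₄ * (2 : ℝ) ^ B₃ * (2 * Real.log x) ^ B₃ * (2 * Real.log x) ^ B₄ * Ca * Cc *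
      (2 * Real.log x) ^ (ka + kc) * Real.log x * Real.log x ^ A ≤ z)
    (hQ₀1 : 320 * C₃ * C₄ * (2 * Real.log x) ^ B₃ * (2 * Real.log x) ^ B₄ * Cd * Cc *
      (2 * Real.log x) ^ (kd + kc) * Real.log x ^ A ≤ Q₀)
    (h3a : 320 * (T * (4 * Real.log x + 1) * (4 * Ce * (2 * Real.log x) ^ ke)) * Real.log x ^ A ≤ P₀)
    (h3b : 128 * (T * (4 * Real.log x + 1) * (4 * Ce * (2 * Real.log x) ^ ke)) * Real.log x ^ A *
      (Q * N * R) ≤ x * P₀)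
    (h3c : 160 * (T * (4 * Real.log x + 1) * (4 * Ce * (2 * Real.log x) ^ ke)) * Real.log x ^ A * R ≤ N)
    (h3d : 64 * (T * (4 * Real.log x + 1) * (4 * Ce * (2 * Real.log x) ^ ke)) * Real.log x ^ A *
      (Q * R ^ 2) ≤ x) :
    S₂ *
        ((ω₀ * C₃ * C₄ * (2 * N) * (2 * M + M / 2) * (2 : ℝ) ^ B₃ * lg ^ B₃ * Real.log (2 * M + M / 2) ^ B₄ / z) *
            ((4 * Ca * Real.log (4 * Q) ^ ka) * (4 * Cc * Real.log (4 * R) ^ kc / R)) +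
          (C₃ * C₄ * (2 * N) * (2 * M + M / 2) * lg ^ B₃ * Real.log (2 * M + M / 2) ^ B₄ / Q₀) *
            ((4 * Cd * Real.log (4 * Q) ^ kd) * (4 * Cc * Real.log (4 * R) ^ kc / R)) +
          (T * (2 * N / (P₀ * R) + 1) * (ω₀ + 1)) *
            ((2 * M + M / 2) * (4 * Ce * Real.log (4 * Q) ^ ke) * 4 +
              (4 * Ce * Q * Real.log (4 * Q) ^ ke) * (2 * R + 1))) ≤
      S₂ * x * R⁻¹ / Real.log x ^ A := by
  have hx0 : 0 < x := by linarith
  have hQ0 : 0 < Q := by linarith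
  have hR0 : 0 < R := by linarith
  have hN00 : 0 < N := by linarith
  have hM0 : 0 < M := by
    by_contra h
    rw [not_lt] at h
    have : M * N ≤ 0 := mul_nonpos_of_nonpos_of_nonneg h hN00.le
    linarith
  have hΛ : 1 ≤ Real.log x := by
    rw [Real.le_log_iff_exp_le hx0]; have := Real.exp_one_lt_d9; linarith
  have hΛ0 : 0 < Real.log x := by linarith
  set Λ := Real.log x with hΛdef
  have hlogQ := log_four_mul_le hx hQ0 hQx
  have hlogQ0 : 0 ≤ Real.log (4 * Q) := Real.log_nonneg (by linarith)
  have hlogR := log_four_mul_le hx hR0 hRx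
  have hlogR0 : 0 ≤ Real.log (4 * R) := Real.log_nonneg (by linarith)
  have hLA : 0 < Λ ^ A := Real.rpow_pos_of_pos hΛ0 A
  -- `lg' = log(5M/2) ≤ 2Λ`
  have hM5 : 2 * M + M / 2 = 5 * M / 2 := by ring
  have hlg' : Real.log (2 * M + M / 2) ≤ 2 * Λ := by
    rw [hM5]
    have e : 2 * Λ = Real.log (x * x) := by rw [hΛdef, Real.log_mul hx0.ne' hx0.ne']; ring
    rw [e]; exact Real.log_le_log (by positivity) (by nlinarith)
  have hlg'0 : 0 ≤ Real.log (2 * M + M / 2) := by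
    rw [hM5]; refine Real.log_nonneg ?_
    have : 1 ≤ M := by
      by_contra h; rw [not_le] at h
      have : M * N < 1 * x := by nlinarith
      linarith
    linarith
  -- rpow bounds
  have r1 : lg ^ B₃ ≤ (2 * Λ) ^ B₃ := Real.rpow_le_rpow hlg0 hlg hB₃
  have r2 : Real.log (2 * M + M / 2) ^ B₄ ≤ (2 * Λ) ^ B₄ := Real.rpow_le_rpow hlg'0 hlg' hB₄
  have r10 : 0 ≤ lg ^ B₃ := Real.rpow_nonneg hlg0 _
  have r20 : 0 ≤ Real.log (2 * M + M / 2) ^ B₄ := Real.rpow_nonneg hlg'0 _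
  have h2B : 0 ≤ (2 : ℝ) ^ B₃ := Real.rpow_nonneg (by norm_num) _
  have p1 : Real.log (4 * Q) ^ ka ≤ (2 * Λ) ^ ka := pow_le_pow_left₀ hlogQ0 hlogQ ka
  have p2 : Real.log (4 * R) ^ kc ≤ (2 * Λ) ^ kc := pow_le_pow_left₀ hlogR0 hlogR kc
  have p3 : Real.log (4 * Q) ^ kd ≤ (2 * Λ) ^ kd := pow_le_pow_left₀ hlogQ0 hlogQ kd
  have p4 : Real.log (4 * Q) ^ ke ≤ (2 * Λ) ^ ke := pow_le_pow_left₀ hlogQ0 hlogQ ke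
  have hxMN : S₂ * x * R⁻¹ = S₂ * M * N * R⁻¹ := by rw [← hMN]; ring
  rw [le_div_iff₀ hLA]
  -- (1)
  have h1 : S₂ * ((ω₀ * C₃ * C₄ * (2 * N) * (2 * M + M / 2) * (2 : ℝ) ^ B₃ * lg ^ B₃ *
      Real.log (2 * M + M / 2) ^ B₄ / z) * ((4 * Ca * Real.log (4 * Q) ^ ka) * (4 * Cc * Real.log (4 * R) ^ kc / R))) *
      Λ ^ A ≤ S₂ * x * R⁻¹ / 4 := by
    calc _ ≤ S₂ * (((4 * Λ) * C₃ * C₄ * (2 * N) * (2 * M + M / 2) * (2 : ℝ) ^ B₃ * (2 * Λ) ^ B₃ *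
          (2 * Λ) ^ B₄ / z) * ((4 * Ca * (2 * Λ) ^ ka) * (4 * Cc * (2 * Λ) ^ kc / R))) * Λ ^ A := by
          gcongr
      _ = S₂ * M * N * R⁻¹ / 4 * ((1280 * C₃ * C₄ * (2 : ℝ) ^ B₃ * (2 * Λ) ^ B₃ * (2 * Λ) ^ B₄ * Ca * Cc *
          (2 * Λ) ^ (ka + kc) * Λ * Λ ^ A) / z) := by
          rw [pow_add]; field_simp; ring
      _ ≤ S₂ * M * N * R⁻¹ / 4 * 1 := by
          refine mul_le_mul_of_nonneg_left ?_ (by positivity)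
          rw [div_le_one hz]; exact hz1
      _ = S₂ * x * R⁻¹ / 4 := by rw [hxMN, mul_one]
  -- (2)
  have h2 : S₂ * ((C₃ * C₄ * (2 * N) * (2 * M + M / 2) * lg ^ B₃ * Real.log (2 * M + M / 2) ^ B₄ / Q₀) *
      ((4 * Cd * Real.log (4 * Q) ^ kd) * (4 * Cc * Real.log (4 * R) ^ kc / R))) * Λ ^ A ≤ S₂ * x * R⁻¹ / 4 := by
    calc _ ≤ S₂ * ((C₃ * C₄ * (2 * N) * (2 * M + M / 2) * (2 * Λ) ^ B₃ * (2 * Λ) ^ B₄ / Q₀) *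
          ((4 * Cd * (2 * Λ) ^ kd) * (4 * Cc * (2 * Λ) ^ kc / R))) * Λ ^ A := by gcongr
      _ = S₂ * M * N * R⁻¹ / 4 * ((320 * C₃ * C₄ * (2 * Λ) ^ B₃ * (2 * Λ) ^ B₄ * Cd * Cc *
          (2 * Λ) ^ (kd + kc) * Λ ^ A) / Q₀) := by
          rw [pow_add]; field_simp; ring
      _ ≤ S₂ * M * N * R⁻¹ / 4 * 1 := by
          refine mul_le_mul_of_nonneg_left ?_ (by positivity)
          rw [div_le_one hQ₀]; exact hQ₀1
      _ = S₂ * x * R⁻¹ / 4 := by rw [hxMN, mul_one]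
  -- (3)
  set Φ : ℝ := T * (4 * Λ + 1) * (4 * Ce * (2 * Λ) ^ ke) with hΦ
  have hΦ0 : 0 ≤ Φ := by positivity
  have h3 : S₂ * ((T * (2 * N / (P₀ * R) + 1) * (ω₀ + 1)) *
      ((2 * M + M / 2) * (4 * Ce * Real.log (4 * Q) ^ ke) * 4 + (4 * Ce * Q * Real.log (4 * Q) ^ ke) * (2 * R + 1))) *
      Λ ^ A ≤ S₂ * x * R⁻¹ / 2 := by
    have hR4 : 2 * R + 1 ≤ 4 * R := by linarith
    calc _ ≤ S₂ * ((T * (2 * N / (P₀ * R) + 1) * ((4 * Λ) + 1)) *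
          ((2 * M + M / 2) * (4 * Ce * (2 * Λ) ^ ke) * 4 + (4 * Ce * Q * (2 * Λ) ^ ke) * (4 * R))) * Λ ^ A := by
          gcongr
      _ = S₂ * Φ * Λ ^ A * ((2 * N / (P₀ * R) + 1) * (10 * M + 4 * Q * R)) := by rw [hΦ]; ring
      _ = S₂ * R⁻¹ / 16 * ((320 * Φ * Λ ^ A) / P₀ * (M * N)) + S₂ * R⁻¹ / 16 * ((128 * Φ * Λ ^ A * (Q * N * R)) / P₀) +
          S₂ * R⁻¹ / 16 * (160 * Φ * Λ ^ A * R * M) + S₂ * R⁻¹ / 16 * (64 * Φ * Λ ^ A * (Q * R ^ 2)) := by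
          field_simp; ring
      _ ≤ S₂ * R⁻¹ / 16 * (1 * (M * N)) + S₂ * R⁻¹ / 16 * x + S₂ * R⁻¹ / 16 * (N * M) + S₂ * R⁻¹ / 16 * x := by
          have i1 : (320 * Φ * Λ ^ A) / P₀ ≤ 1 := by rw [div_le_one hP₀]; exact h3a
          have i2 : (128 * Φ * Λ ^ A * (Q * N * R)) / P₀ ≤ x := by rw [div_le_iff₀ hP₀]; exact h3b
          have i3 : 160 * Φ * Λ ^ A * R * M ≤ N * M := mul_le_mul_of_nonneg_right h3c hM0.le
          gcongr
      _ = S₂ * x * R⁻¹ / 2 - S₂ * x * R⁻¹ / 4 - S₂ * x * R⁻¹ / 8 + S₂ * x * R⁻¹ / 8 := by rw [← hMN]; ring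
      _ ≤ S₂ * x * R⁻¹ / 2 := by
          have : 0 ≤ S₂ * x * R⁻¹ := by positivity
          linarith
  have e : S₂ *
        ((ω₀ * C₃ * C₄ * (2 * N) * (2 * M + M / 2) * (2 : ℝ) ^ B₃ * lg ^ B₃ * Real.log (2 * M + M / 2) ^ B₄ / z) *
            ((4 * Ca * Real.log (4 * Q) ^ ka) * (4 * Cc * Real.log (4 * R) ^ kc / R)) +
          (C₃ * C₄ * (2 * N) * (2 * M + M / 2) * lg ^ B₃ * Real.log (2 * M + M / 2) ^ B₄ / Q₀) *
            ((4 * Cd * Real.log (4 * Q) ^ kd) * (4 * Cc * Real.log (4 * R) ^ kc / R)) +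
          (T * (2 * N / (P₀ * R) + 1) * (ω₀ + 1)) *
            ((2 * M + M / 2) * (4 * Ce * Real.log (4 * Q) ^ ke) * 4 +
              (4 * Ce * Q * Real.log (4 * Q) ^ ke) * (2 * R + 1))) * Λ ^ A =
      S₂ * ((ω₀ * C₃ * C₄ * (2 * N) * (2 * M + M / 2) * (2 : ℝ) ^ B₃ * lg ^ B₃ *
        Real.log (2 * M + M / 2) ^ B₄ / z) * ((4 * Ca * Real.log (4 * Q) ^ ka) * (4 * Cc * Real.log (4 * R) ^ kc / R))) *
        Λ ^ A +
      S₂ * ((C₃ * C₄ * (2 * N) * (2 * M + M / 2) * lg ^ B₃ * Real.log (2 * M + M / 2) ^ B₄ / Q₀) *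
        ((4 * Cd * Real.log (4 * Q) ^ kd) * (4 * Cc * Real.log (4 * R) ^ kc / R))) * Λ ^ A +
      S₂ * ((T * (2 * N / (P₀ * R) + 1) * (ω₀ + 1)) *
        ((2 * M + M / 2) * (4 * Ce * Real.log (4 * Q) ^ ke) * 4 + (4 * Ce * Q * Real.log (4 * Q) ^ ke) * (2 * R + 1))) *
        Λ ^ A := by ring
  rw [e]
  linarith [h1, h2, h3]

/-! ### E3 -/

set_option maxHeartbeats 400000 in
/-- **E3 numerics**: the right-hand side of `BFI.e3_le` at `Y = M/2` is `≤ S₂ x R⁻¹ Λ^{−A}` once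
`H ≤ 16x^{ε₁}Q²R/M`, `3072K_jC_b²(2Λ)^{2k_b}Q₀Λ^A R (H+1) θ^j ≤ 1` and
`786432π|a|C_b²(2Λ)^{2k_b}Q₀²Λ^A x^{2ε₁} Q²R²N ≤ x²` (`Λ = log x`). [folklore] -/
theorem e3_num {x M N Q R S₂ A Q₀ θ Kj Cb aabs H ε₁ : ℝ} {j kb : ℕ} (hx : 16 ≤ x) (hMN : M * N = x)
    (hN0 : 1 ≤ N) (hQ : 1 / 2 ≤ Q) (hQx : Q ≤ 2 * x) (hR : 1 / 2 ≤ R) (hS₂ : 0 ≤ S₂) (hQ₀ : 0 ≤ Q₀)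
    (hθ : 0 ≤ θ) (hKj : 0 ≤ Kj) (haabs : 0 ≤ aabs) (hH0 : 0 ≤ H) (hHle : H ≤ 16 * x ^ ε₁ * Q ^ 2 * R / M)
    (htail : 3072 * Kj * Cb ^ 2 * (2 * Real.log x) ^ (2 * kb) * Q₀ * Real.log x ^ A * R * (H + 1) * θ ^ j ≤ 1)
    (hphase : 786432 * π * aabs * Cb ^ 2 * (2 * Real.log x) ^ (2 * kb) * Q₀ ^ 2 * Real.log x ^ A *
      x ^ (2 * ε₁) * (Q ^ 2 * R ^ 2 * N) ≤ x ^ 2) :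
    (Q₀ / (Q ^ 2 * R) * (16 * Kj * (M / 2 * (H + 1)) * θ ^ j) +
        (Q₀ / (Q ^ 2 * R)) ^ 2 * (4 * π * aabs * (M + 2 * (M / 2)) * H ^ 2 / N)) *
      ((2 * R + 1) * (4 * Cb * Q * Real.log (4 * Q) ^ kb) ^ 2 * ((2 * N + 1) * S₂)) ≤
      S₂ * x * R⁻¹ / Real.log x ^ A := by
  have hx0 : 0 < x := by linarith
  have hQ0 : 0 < Q := by linarith
  have hR0 : 0 < R := by linarith
  have hN00 : 0 < N := by linarith
  have hM0 : 0 < M := by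
    by_contra h
    rw [not_lt] at h
    have : M * N ≤ 0 := mul_nonpos_of_nonpos_of_nonneg h hN00.le
    linarith
  have hΛ : 1 ≤ Real.log x := by
    rw [Real.le_log_iff_exp_le hx0]; have := Real.exp_one_lt_d9; linarith
  have hΛ0 : 0 < Real.log x := by linarith
  set Λ := Real.log x with hΛdef
  have hlogQ := log_four_mul_le hx hQ0 hQx
  have hlogQ0 : 0 ≤ Real.log (4 * Q) := Real.log_nonneg (by linarith)
  have hLA : 0 < Λ ^ A := Real.rpow_pos_of_pos hΛ0 A
  have p1 : Real.log (4 * Q) ^ kb ≤ (2 * Λ) ^ kb := pow_le_pow_left₀ hlogQ0 hlogQ kb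
  have hR4 : 2 * R + 1 ≤ 4 * R := by linarith
  have hN3 : 2 * N + 1 ≤ 3 * N := by linarith
  have hxMN : S₂ * x * R⁻¹ = S₂ * M * N * R⁻¹ := by rw [← hMN]; ring
  have hxε : 0 < x ^ (2 * ε₁) := Real.rpow_pos_of_pos hx0 _
  rw [le_div_iff₀ hLA]
  -- bound the common factor `G`
  have hG : (2 * R + 1) * (4 * Cb * Q * Real.log (4 * Q) ^ kb) ^ 2 * ((2 * N + 1) * S₂) ≤
      (4 * R) * (4 * Cb * Q * (2 * Λ) ^ kb) ^ 2 * ((3 * N) * S₂) := by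
    have : (4 * Cb * Q * Real.log (4 * Q) ^ kb) ^ 2 ≤ (4 * Cb * Q * (2 * Λ) ^ kb) ^ 2 := by
      rw [mul_pow, mul_pow, mul_pow (4 * Cb * Q), mul_pow (4 * Cb)]
      gcongr
    exact mul_le_mul (mul_le_mul hR4 this (sq_nonneg _) (by positivity)) (mul_le_mul_of_nonneg_right hN3 hS₂)
      (by positivity) (by positivity)
  have hG0 : 0 ≤ (2 * R + 1) * (4 * Cb * Q * Real.log (4 * Q) ^ kb) ^ 2 * ((2 * N + 1) * S₂) := by positivity
  have hpre0 : 0 ≤ Q₀ / (Q ^ 2 * R) * (16 * Kj * (M / 2 * (H + 1)) * θ ^ j) +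
      (Q₀ / (Q ^ 2 * R)) ^ 2 * (4 * π * aabs * (M + 2 * (M / 2)) * H ^ 2 / N) := by positivity
  calc (Q₀ / (Q ^ 2 * R) * (16 * Kj * (M / 2 * (H + 1)) * θ ^ j) +
        (Q₀ / (Q ^ 2 * R)) ^ 2 * (4 * π * aabs * (M + 2 * (M / 2)) * H ^ 2 / N)) *
        ((2 * R + 1) * (4 * Cb * Q * Real.log (4 * Q) ^ kb) ^ 2 * ((2 * N + 1) * S₂)) * Λ ^ A
      ≤ (Q₀ / (Q ^ 2 * R) * (16 * Kj * (M / 2 * (H + 1)) * θ ^ j) +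
        (Q₀ / (Q ^ 2 * R)) ^ 2 * (4 * π * aabs * (M + 2 * (M / 2)) * H ^ 2 / N)) *
        ((4 * R) * (4 * Cb * Q * (2 * Λ) ^ kb) ^ 2 * ((3 * N) * S₂)) * Λ ^ A :=
        mul_le_mul_of_nonneg_right (mul_le_mul_of_nonneg_left hG hpre0) hLA.le
    _ = S₂ * M * N * R⁻¹ / 2 * (3072 * Kj * Cb ^ 2 * (2 * Λ) ^ (2 * kb) * Q₀ * Λ ^ A * R * (H + 1) * θ ^ j) +
        S₂ * R⁻¹ / 2 * (3072 * π * aabs * Cb ^ 2 * (2 * Λ) ^ (2 * kb) * Q₀ ^ 2 * Λ ^ A * (M * H ^ 2) / Q ^ 2) := by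
        rw [show 2 * kb = kb + kb by ring, pow_add]; field_simp; ring
    _ ≤ S₂ * M * N * R⁻¹ / 2 * 1 +
        S₂ * R⁻¹ / 2 * (3072 * π * aabs * Cb ^ 2 * (2 * Λ) ^ (2 * kb) * Q₀ ^ 2 * Λ ^ A *
          (256 * x ^ (2 * ε₁) * Q ^ 4 * R ^ 2 / M) / Q ^ 2) := by
        have hMH : M * H ^ 2 ≤ 256 * x ^ (2 * ε₁) * Q ^ 4 * R ^ 2 / M := by
          rw [le_div_iff₀ hM0]
          have h1 : M * H ≤ 16 * x ^ ε₁ * Q ^ 2 * R := by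
            rw [le_div_iff₀ hM0] at hHle; linarith
          have h0 : 0 ≤ M * H := by positivity
          calc M * H ^ 2 * M = (M * H) ^ 2 := by ring
            _ ≤ (16 * x ^ ε₁ * Q ^ 2 * R) ^ 2 := pow_le_pow_left₀ h0 h1 2
            _ = 256 * x ^ (2 * ε₁) * Q ^ 4 * R ^ 2 := by
                rw [show x ^ (2 * ε₁) = (x ^ ε₁) ^ 2 by rw [← Real.rpow_natCast, ← Real.rpow_mul hx0.le]; ring_nf]
                ring
        gcongr
    _ = S₂ * M * N * R⁻¹ / 2 + S₂ * M * N * R⁻¹ / 2 *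
        ((786432 * π * aabs * Cb ^ 2 * (2 * Λ) ^ (2 * kb) * Q₀ ^ 2 * Λ ^ A * x ^ (2 * ε₁) * (Q ^ 2 * R ^ 2 * N)) /
          (x * (M * N))) := by
        rw [← hMN]; field_simp; ring
    _ ≤ S₂ * M * N * R⁻¹ / 2 + S₂ * M * N * R⁻¹ / 2 * 1 := by
        have : (786432 * π * aabs * Cb ^ 2 * (2 * Λ) ^ (2 * kb) * Q₀ ^ 2 * Λ ^ A * x ^ (2 * ε₁) * (Q ^ 2 * R ^ 2 * N)) /
            (x * (M * N)) ≤ 1 := by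
          rw [hMN, div_le_one (by positivity)]; rw [sq] at hphase ⊢; nlinarith [hphase]
        gcongr
    _ = S₂ * x * R⁻¹ := by rw [hxMN]; ring


/-! ### E4 -/

/-- `√(a + b) ≤ √a + √b` for `a, b ≥ 0`. [folklore] -/
theorem sqrt_add_le' {a b : ℝ} (ha : 0 ≤ a) (hb : 0 ≤ b) : Real.sqrt (a + b) ≤ Real.sqrt a + Real.sqrt b := by
  rw [Real.sqrt_le_left (by positivity)]
  nlinarith [Real.sq_sqrt ha, Real.sq_sqrt hb, Real.sqrt_nonneg a, Real.sqrt_nonneg b]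

set_option maxHeartbeats 1600000 in
/-- **E4 numerics** (BFI (9.21) and the range of Theorem 2): with `Y = M/2`, `Λ = log x`, the bound
of `BFI.e4_le` is `≤ S₂ x R⁻¹ Λ^{−A}` provided `L ≤ C₇P^η S₂ H · Br` (Lemma 7 after (9.20), `Br` the
bracket `8N²Q²/R + 48(DC₅)^{1/2}N^{ε₅/2}(N^{5/2}Q + N²Q^{3/2})`), `1 ≤ H ≤ 16x^{ε₁}Q²R/M`, the three
range inequalities `NQ/√R, (N^{5/2}Q)^{1/2}, (N²Q^{3/2})^{1/2} ≤ x^{1/2−ε₀}`, `Γ_Q ≤ QΓ'`, and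
`Ψ Λ^A ≤ x^{ε₀}` for the explicit polylogarithmic factor `Ψ`. [cite: BombieriFriedlanderIwaniecActa1986, §9 (9.21) p. 231] -/
theorem e4_num {x M N Q R S₂ A Q₀ ΓQ Γ' L C₇ Pη H τa D C₅ ε₀ ε₁ ε₅ : ℝ} {Dτ : ℕ} (hx : 16 ≤ x)
    (hMN : M * N = x) (hN0 : 1 ≤ N) (hNx : N ≤ x) (hQ : 1 / 2 ≤ Q) (hR : 1 / 2 ≤ R) (hRN : R ≤ N)
    (hS₂ : 0 ≤ S₂) (hQ₀ : 1 ≤ Q₀) (hQ₀x : Q₀ ≤ x) (hΓ'0 : 0 ≤ Γ') (hΓ : ΓQ ≤ Q * Γ')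
    (hΓQ0 : 0 ≤ ΓQ) (hC₇ : 0 ≤ C₇) (hPη : 0 ≤ Pη) (hτa : 0 ≤ τa)
    (hH1 : 1 ≤ H) (hHle : H ≤ 16 * x ^ ε₁ * Q ^ 2 * R / M)
    (hL : L ≤ C₇ * Pη * S₂ * H * (8 * N ^ 2 * Q ^ 2 / R +
      48 * Real.sqrt (D * C₅) * N ^ (ε₅ / 2) * (N ^ (5 / 2 : ℝ) * Q + N ^ 2 * Q ^ (3 / 2 : ℝ))))
    (hr1 : N * Q / Real.sqrt R ≤ x ^ (1 / 2 - ε₀)) (hr2 : Real.sqrt (N ^ (5 / 2 : ℝ) * Q) ≤ x ^ (1 / 2 - ε₀))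
    (hr3 : Real.sqrt (N ^ 2 * Q ^ (3 / 2 : ℝ)) ≤ x ^ (1 / 2 - ε₀))
    (hbig : (4 * Q₀ * τa * (2 * (2 * Real.log x) + 1) * (3 * Q₀) * (2 * Real.sqrt (32 * derivConst 2)) *
        (2 + 3 * Real.log x) * Γ' * Real.sqrt (Dτ : ℝ) * Real.sqrt (C₇ * Pη) * (4 * x ^ (ε₁ / 2)) *
        (Real.sqrt 8 + 2 * Real.sqrt (48 * Real.sqrt (D * C₅) * N ^ (ε₅ / 2)))) * Real.log x ^ A ≤ x ^ ε₀) :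
    2 * (Q₀ * (τa * 2 * (2 * Real.log (N / R) + 1) *
        ((3 * M * Q₀ / (Q ^ 2 * R)) * (2 * π * Real.sqrt (8 * (M + 2 * (M / 2)) * fourierDecayConst (M / 2))) *
          (2 + Real.log (3 * Q₀ * N + 2)) *
          ((Real.sqrt (N / R) * ΓQ * Real.sqrt S₂) * Real.sqrt (Dτ * L))))) ≤
      S₂ * x * R⁻¹ / Real.log x ^ A := by
  have hx0 : 0 < x := by linarith
  have hQ0 : 0 < Q := by linarith
  have hR0 : 0 < R := by linarith
  have hN00 : 0 < N := by linarith
  have hM0 : 0 < M := by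
    by_contra h
    rw [not_lt] at h
    have : M * N ≤ 0 := mul_nonpos_of_nonpos_of_nonneg h hN00.le
    linarith
  have hΛ : 1 ≤ Real.log x := by
    rw [Real.le_log_iff_exp_le hx0]; have := Real.exp_one_lt_d9; linarith
  have hΛ0 : 0 < Real.log x := by linarith
  set Λ := Real.log x with hΛdef
  have hLA : 0 < Λ ^ A := Real.rpow_pos_of_pos hΛ0 A
  have hK2 := one_le_derivConst 2
  -- (s1) the constant `2π (8(M+2Y)B₀)^{1/2} = 2 √(32 K₂)`
  have hs1 : 2 * π * Real.sqrt (8 * (M + 2 * (M / 2)) * fourierDecayConst (M / 2)) =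
      2 * Real.sqrt (32 * derivConst 2) := by
    unfold fourierDecayConst
    have e : 8 * (M + 2 * (M / 2)) * (derivConst 2 / (π ^ 2 * (M / 2))) = (32 * derivConst 2) / π ^ 2 := by
      field_simp; ring
    rw [e, Real.sqrt_div (by positivity), Real.sqrt_sq Real.pi_pos.le]
    field_simp
  -- (s2) logs
  have hlogNR : Real.log (N / R) ≤ 2 * Λ := by
    have h1 : N / R ≤ 2 * N := by
      rw [div_le_iff₀ hR0]; nlinarith
    have e : 2 * Λ = Real.log (x * x) := by rw [hΛdef, Real.log_mul hx0.ne' hx0.ne']; ring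
    rw [e]; exact Real.log_le_log (by positivity) (by nlinarith)
  have hlogNR0 : 0 ≤ Real.log (N / R) := Real.log_nonneg (by rw [le_div_iff₀ hR0]; linarith)
  have hlog3 : Real.log (3 * Q₀ * N + 2) ≤ 3 * Λ := by
    have e : 3 * Λ = Real.log (x ^ 3) := by rw [hΛdef, Real.log_pow]; push_cast; ring
    rw [e]; refine Real.log_le_log (by positivity) ?_
    have : Q₀ * N ≤ x * x := mul_le_mul hQ₀x hNx hN00.le hx0.le
    nlinarith
  have hlog30 : 0 ≤ Real.log (3 * Q₀ * N + 2) := Real.log_nonneg (by nlinarith)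
  -- (s3) `√H ≤ 4 x^{ε₁/2} Q √R / √M`
  have hsH : Real.sqrt H ≤ 4 * x ^ (ε₁ / 2) * Q * Real.sqrt R / Real.sqrt M := by
    have e : 4 * x ^ (ε₁ / 2) * Q * Real.sqrt R / Real.sqrt M = Real.sqrt (16 * x ^ ε₁ * Q ^ 2 * R / M) := by
      rw [Real.sqrt_div (by positivity), Real.sqrt_mul (by positivity), Real.sqrt_mul (by positivity),
        Real.sqrt_mul (by norm_num), Real.sqrt_sq hQ0.le, show (16 : ℝ) = 4 ^ 2 by norm_num,
        Real.sqrt_sq (by norm_num), show x ^ ε₁ = (x ^ (ε₁ / 2)) ^ 2 by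
          rw [← Real.rpow_natCast, ← Real.rpow_mul hx0.le]; ring_nf, Real.sqrt_sq (by positivity)]
    rw [e]; exact Real.sqrt_le_sqrt hHle
  -- (s4) `√Br ≤ x^{1/2-ε₀} (√8 + 2 √(48 √(DC₅) N^{ε₅/2}))`
  set Br : ℝ := 8 * N ^ 2 * Q ^ 2 / R + 48 * Real.sqrt (D * C₅) * N ^ (ε₅ / 2) *
    (N ^ (5 / 2 : ℝ) * Q + N ^ 2 * Q ^ (3 / 2 : ℝ)) with hBr
  have hBr0 : 0 ≤ Br := by positivity
  set cD : ℝ := 48 * Real.sqrt (D * C₅) * N ^ (ε₅ / 2) with hcD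
  have hcD0 : 0 ≤ cD := by positivity
  have hsBr : Real.sqrt Br ≤ x ^ (1 / 2 - ε₀) * (Real.sqrt 8 + 2 * Real.sqrt cD) := by
    have h1 : Real.sqrt (8 * N ^ 2 * Q ^ 2 / R) = Real.sqrt 8 * (N * Q / Real.sqrt R) := by
      rw [show 8 * N ^ 2 * Q ^ 2 / R = 8 * ((N * Q) ^ 2 / R) by ring, Real.sqrt_mul (by norm_num),
        Real.sqrt_div (by positivity), Real.sqrt_sq (by positivity)]
    have h2 : Real.sqrt (cD * (N ^ (5 / 2 : ℝ) * Q + N ^ 2 * Q ^ (3 / 2 : ℝ))) ≤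
        Real.sqrt cD * (x ^ (1 / 2 - ε₀) + x ^ (1 / 2 - ε₀)) := by
      rw [Real.sqrt_mul hcD0]
      refine mul_le_mul_of_nonneg_left ((sqrt_add_le' (by positivity) (by positivity)).trans
        (add_le_add hr2 hr3)) (Real.sqrt_nonneg _)
    calc Real.sqrt Br ≤ Real.sqrt (8 * N ^ 2 * Q ^ 2 / R) +
          Real.sqrt (cD * (N ^ (5 / 2 : ℝ) * Q + N ^ 2 * Q ^ (3 / 2 : ℝ))) := by
          rw [hBr, hcD]; exact sqrt_add_le' (by positivity) (by positivity)
      _ ≤ Real.sqrt 8 * x ^ (1 / 2 - ε₀) + Real.sqrt cD * (x ^ (1 / 2 - ε₀) + x ^ (1 / 2 - ε₀)) := by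
          rw [h1]; gcongr
      _ = x ^ (1 / 2 - ε₀) * (Real.sqrt 8 + 2 * Real.sqrt cD) := by ring
  -- (s2') `√(Dτ L) ≤ √Dτ √(C₇Pη) √S₂ √H √Br`
  have hsL : Real.sqrt (Dτ * L) ≤ Real.sqrt (Dτ : ℝ) * (Real.sqrt (C₇ * Pη) * Real.sqrt S₂ * Real.sqrt H * Real.sqrt Br) := by
    rw [Real.sqrt_mul (Nat.cast_nonneg _)]
    refine mul_le_mul_of_nonneg_left ?_ (Real.sqrt_nonneg _)
    calc Real.sqrt L ≤ Real.sqrt (C₇ * Pη * S₂ * H * Br) := Real.sqrt_le_sqrt (by rw [hBr]; exact hL)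
      _ = _ := by
          rw [Real.sqrt_mul (by positivity), Real.sqrt_mul (by positivity), Real.sqrt_mul (by positivity)]
  -- nonnegativity of pieces
  have hsS : Real.sqrt S₂ * Real.sqrt S₂ = S₂ := Real.mul_self_sqrt hS₂
  have hsMN : Real.sqrt M * Real.sqrt N = Real.sqrt x := by rw [← Real.sqrt_mul hM0.le, hMN]
  have hsx : Real.sqrt x * Real.sqrt x = x := Real.mul_self_sqrt hx0.le
  have hxhalf : x ^ (1 / 2 - ε₀) * x ^ ε₀ = Real.sqrt x := by
    rw [← Real.rpow_add hx0, show 1 / 2 - ε₀ + ε₀ = 1 / 2 by ring, Real.sqrt_eq_rpow]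
  have hsR : Real.sqrt R * Real.sqrt R = R := Real.mul_self_sqrt hR0.le
  have hsRpos : 0 < Real.sqrt R := Real.sqrt_pos.2 hR0
  have hsMpos : 0 < Real.sqrt M := Real.sqrt_pos.2 hM0
  -- main estimate: bound everything by the product form
  set Ψ : ℝ := 4 * Q₀ * τa * (2 * (2 * Λ) + 1) * (3 * Q₀) * (2 * Real.sqrt (32 * derivConst 2)) *
    (2 + 3 * Λ) * Γ' * Real.sqrt (Dτ : ℝ) * Real.sqrt (C₇ * Pη) * (4 * x ^ (ε₁ / 2)) *
    (Real.sqrt 8 + 2 * Real.sqrt cD) with hΨ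
  have hΨ0 : 0 ≤ Ψ := by positivity
  rw [le_div_iff₀ hLA, hs1]
  calc 2 * (Q₀ * (τa * 2 * (2 * Real.log (N / R) + 1) *
        ((3 * M * Q₀ / (Q ^ 2 * R)) * (2 * Real.sqrt (32 * derivConst 2)) *
          (2 + Real.log (3 * Q₀ * N + 2)) *
          ((Real.sqrt (N / R) * ΓQ * Real.sqrt S₂) * Real.sqrt (Dτ * L))))) * Λ ^ A
      ≤ 2 * (Q₀ * (τa * 2 * (2 * (2 * Λ) + 1) *
        ((3 * M * Q₀ / (Q ^ 2 * R)) * (2 * Real.sqrt (32 * derivConst 2)) *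
          (2 + 3 * Λ) *
          ((Real.sqrt (N / R) * (Q * Γ') * Real.sqrt S₂) *
            (Real.sqrt (Dτ : ℝ) * (Real.sqrt (C₇ * Pη) * Real.sqrt S₂ *
              (4 * x ^ (ε₁ / 2) * Q * Real.sqrt R / Real.sqrt M) * (x ^ (1 / 2 - ε₀) * (Real.sqrt 8 + 2 * Real.sqrt cD)))))))) *
        Λ ^ A := by
        have hQ₀0 : 0 ≤ Q₀ := by linarith
        have i1 : Real.sqrt (Dτ * L) ≤ Real.sqrt (Dτ : ℝ) * (Real.sqrt (C₇ * Pη) * Real.sqrt S₂ *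
            (4 * x ^ (ε₁ / 2) * Q * Real.sqrt R / Real.sqrt M) * (x ^ (1 / 2 - ε₀) * (Real.sqrt 8 + 2 * Real.sqrt cD))) := by
          refine hsL.trans (mul_le_mul_of_nonneg_left ?_ (Real.sqrt_nonneg _))
          exact mul_le_mul (mul_le_mul_of_nonneg_left hsH (by positivity)) hsBr (Real.sqrt_nonneg _) (by positivity)
        gcongr
    _ = S₂ * R⁻¹ * (Real.sqrt M * Real.sqrt N) * x ^ (1 / 2 - ε₀) * (Ψ * Λ ^ A) := by
        rw [hΨ, Real.sqrt_div hN00.le]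
        have hsM : Real.sqrt M * Real.sqrt M = M := Real.mul_self_sqrt hM0.le
        nth_rw 1 [← hsM]
        conv_rhs => rw [← hsS]
        field_simp
        ring
    _ ≤ S₂ * R⁻¹ * (Real.sqrt M * Real.sqrt N) * x ^ (1 / 2 - ε₀) * x ^ ε₀ := by
        refine mul_le_mul_of_nonneg_left ?_ (by positivity)
        rw [hΨ]; exact hbig
    _ = S₂ * x * R⁻¹ := by
        rw [hsMN, mul_assoc, hxhalf, mul_assoc, mul_assoc, hsx]; ring

end BFI

end Literature.NumberTheory.Sieve
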